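import Summits.Ventures.HSemireg.WedgeHankelRecurrenceGaussChebyshevNodesHoffmanWielandt

/-!
# Venture HSemireg — **GAUSS–LEGENDRE NODES VERSUS SECOND-KIND GAUSS–CHEBYSHEV NODES, UNIFORMLY IN THE DEGREE**: the monic Legendre recurrence has `b_k = k²∕(4k² − 1) = 1∕4 + 1∕(4(4k²−1))`, the
# `U`-recurrence has `b ≡ 1∕4`, and `(√b_k − 1∕2)² ≤ 1∕(48(4k² − 1))` with `Σ_{k≤t} 1∕(4k²−1) = t∕(2t+1)`; Hoffman–Wielandt (N417) gives for EVERY `t` and the increasing zeros `x` of `P_{t+1}`: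
# **`Σ_{k≤t} (cos((k'+1)π∕(t+2)) − x_k)² ≤ 1∕48`** (`k' = t − k`), hence each pair differs by at most `3∕20`

HONEST FRAMING. Part of the Lean index of the computation cell `pub-hsemireg` (seat p10 gen 47, Sunday typer «UNIFORM-IN-n»).  Real finite sums, `Real.cos`, `Real.sqrt` only; no variety, no
cohomology theory, no sheaf, no Ext group and no semiregularity map is constructed here; nothing here says that HC / HC_CM / HC_AV holds; no Literature fact (unproved `Prop`) is declared or used.
Custodian versions as in `WedgeHankelSiegelIdeal` (1/3).
SOURCES (cited).  A. J. Hoffman, H. W. Wielandt, Duke Math. J. 20 (1953) 37–39; G. H. Golub, J. H. Welsch, Math. Comp. 23 (1969) 221–230; W. Gautschi, *Orthogonal Polynomials: Computation and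
Approximation* (2004), §3.1; G. Szegő, *Orthogonal Polynomials*, (4.5.x) (Legendre recurrence), §6.21 (comparison of the zeros of Legendre and Chebyshev polynomials).  The uniform bound is the
COROLLARY typed here of N417.
PROOF TYPED HERE.  N417 `hoffman_wielandt_recurrence`; §1125 `chebyshevU_recurrence_eq_prod`, `chebyshevU_nodes_strictMono`, `recurrence_of_coefficients`; the scalar estimate
`(1∕2 − √(k²∕(4k²−1)))² ≤ 1∕(48(4k²−1))` and the telescoping sum `Σ_{i<t} 1∕(4(i+1)²−1) = t∕(2t+1)`.
DEDUP DISCLOSURE (`rg -n -i 'legendre.*nodes|legendre_cheb' Summits/Ventures/HSemireg`, 2026-09-04): §1155 `legendre_zeros_mem` (location in `(−1,1)`), `legendre_zeros_sq_sum`; 0 hits for the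
4 names below.

WHAT IS IN THE TREE.  N417 `hoffman_wielandt_recurrence`; N435 `chebyshev_nodes_hoffman_wielandt` (the `T` versus `U` analogue); §1125 Chebyshev-`U` recurrence facts.
THIS FILE (namespace `Summit.Ventures.HSemireg.Wedge.HankelOuter` continued; CHAINED on N435; 0 definitions):
* §1201 `sqrt_legendre_coeff_sub_half_sq_le`, `sum_one_div_four_sq_sub_one`, **`legendre_chebyshevU_nodes_hoffman_wielandt`** (`≤ 1∕48`), `legendre_chebyshevU_nodes_sub_abs_le` (`≤ 3∕20`).
CAVEATS.  The Legendre zeros enter as any increasing `x` with `q_{t+1} = ∏(X − x_k)` for the chapter's Legendre recurrence (they exist by §11xx `recurrence_zeros_interlace`); uniform in `t`,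
not sharp.  Nothing Ext-side.  New names only.
-/

open Module Polynomial Real
open scoped Matrix Polynomial

namespace Summit.Ventures.HSemireg.Wedge.HankelOuter

/-! ## §1201. Legendre versus second-kind Chebyshev nodes -/

/-- `(√(1∕4) − √((k+1)²∕(4(k+1)²−1)))² ≤ 1∕48 · 1∕(4(k+1)²−1)`. [bookkeeping; this file, §1201] -/
theorem sqrt_legendre_coeff_sub_half_sq_le (k : ℕ) :
    (Real.sqrt (1 / 4) - Real.sqrt (((k : ℝ) + 1) ^ 2 / (4 * ((k : ℝ) + 1) ^ 2 - 1))) ^ 2 ≤ 1 / 48 * (1 / (4 * ((k : ℝ) + 1) ^ 2 - 1)) := by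
  have hk : (0 : ℝ) ≤ k := Nat.cast_nonneg k
  set D : ℝ := 4 * ((k : ℝ) + 1) ^ 2 - 1 with hD
  set u : ℝ := ((k : ℝ) + 1) ^ 2 with hu
  have hDu : D = 4 * u - 1 := by simp only [hD, hu]
  have hu1 : 1 ≤ u := by rw [hu]; nlinarith
  have hD0 : 0 < D := by rw [hDu]; linarith
  have h4 : Real.sqrt (1 / 4) = 1 / 2 := by rw [show (1 / 4 : ℝ) = (1 / 2) ^ 2 by norm_num, Real.sqrt_sq (by norm_num)]
  set s : ℝ := Real.sqrt (u / D) with hs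
  have hs2 : s ^ 2 = u / D := Real.sq_sqrt (div_nonneg (by linarith) hD0.le)
  have hs2' : s ^ 2 * D = u := by rw [hs2]; field_simp
  have hhalf : 1 / 2 ≤ s := by
    rw [hs, Real.le_sqrt (by norm_num), le_div_iff₀ hD0]
    · linarith
    · exact div_nonneg (by linarith) hD0.le
  have he0 : 0 ≤ s - 1 / 2 := by linarith
  have h1 : (s - 1 / 2) * (s + 1 / 2) * (4 * D) = 1 := by linear_combination 4 * hs2' - hDu
  have hDe : 4 * D * (s - 1 / 2) ≤ 1 := by nlinarith [mul_nonneg hD0.le (mul_nonneg he0 he0)]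
  have he' : s - 1 / 2 ≤ 1 / (4 * D) := by rw [le_div_iff₀ (by positivity)]; linarith
  rw [h4]
  calc (1 / 2 - s) ^ 2 = (s - 1 / 2) ^ 2 := by ring
    _ ≤ (1 / (4 * D)) ^ 2 := pow_le_pow_left₀ he0 he' 2
    _ = 1 / (16 * D ^ 2) := by field_simp; ring
    _ ≤ 1 / (48 * D) := one_div_le_one_div_of_le (by positivity) (by nlinarith)
    _ = 1 / 48 * (1 / D) := by rw [one_div_mul_one_div]

/-- `Σ_{i<t} 1∕(4(i+1)² − 1) = t∕(2t+1)` (telescoping). [bookkeeping; this file, §1201] -/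
theorem sum_one_div_four_sq_sub_one (t : ℕ) : ∑ i ∈ Finset.range t, 1 / (4 * ((i : ℝ) + 1) ^ 2 - 1) = (t : ℝ) / (2 * (t : ℝ) + 1) := by
  induction t with
  | zero => simp
  | succ t ih =>
    rw [Finset.sum_range_succ, ih]
    push_cast
    have ht : (0 : ℝ) ≤ t := Nat.cast_nonneg t
    have h2 : (4 * ((t : ℝ) + 1) ^ 2 - 1) = (2 * (t : ℝ) + 1) * (2 * (t : ℝ) + 3) := by ring
    rw [h2, div_add_div _ _ (by positivity) (by positivity), div_eq_div_iff (by positivity) (by positivity)]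
    ring

/-- **`Σ_k (y_k − x_k)² ≤ 1∕48`** for the increasing zeros `x` of the Legendre polynomial `P_{t+1}` (chapter recurrence `a ≡ 0`, `b_k = k²∕(4k²−1)`) and the increasing zeros `y` of `U_{t+1}`,
every `t`. [corollary of Hoffman–Wielandt 1953 via Golub–Welsch 1969; Gautschi §3.1; Szegő §6.21; this file, §1201] -/
theorem legendre_chebyshevU_nodes_hoffman_wielandt {q : ℕ → ℝ[X]} {a b : ℕ → ℝ} (hq0 : q 0 = 1) (hq1 : q 1 = Polynomial.X - C (a 0))
    (hrec : ∀ n, q (n + 2) = (Polynomial.X - C (a (n + 1))) * q (n + 1) - C (b (n + 1)) * q n) (ha : ∀ n, a n = 0)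
    (hb : ∀ n, b (n + 1) = ((n : ℝ) + 1) ^ 2 / (4 * ((n : ℝ) + 1) ^ 2 - 1)) (hb0 : 0 < b 0) {t : ℕ} {x : Fin (t + 1) → ℝ} (hx : StrictMono x)
    (hxq : q (t + 1) = ∏ k, (Polynomial.X - C (x k))) :
    ∑ k, (cos ((((Fin.rev k : Fin (t + 1)) : ℝ) + 1) * π / ((t : ℝ) + 2)) - x k) ^ 2 ≤ 1 / 48 := by
  obtain ⟨q', hq0', hq1', hrec'⟩ := recurrence_of_coefficients (fun _ => (0 : ℝ)) (fun _ => (1 / 4 : ℝ))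
  have hyq := chebyshevU_recurrence_eq_prod (q := q') (a := fun _ => (0 : ℝ)) (b := fun _ => (1 / 4 : ℝ)) hq0' hq1' hrec' (fun _ => rfl) (fun _ => rfl) t
  have hbpos : ∀ j, 0 < b j := fun j => by
    rcases j with _ | n
    · exact hb0
    · rw [hb]
      have h0 : (0 : ℝ) ≤ n := Nat.cast_nonneg n
      have hD : (0 : ℝ) < 4 * ((n : ℝ) + 1) ^ 2 - 1 := by nlinarith
      positivity
  have h := hoffman_wielandt_recurrence (q := q) (q' := q') (a := a) (a' := fun _ => (0 : ℝ)) (b := b) (b' := fun _ => (1 / 4 : ℝ))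
    hq0 hq1 hrec hq0' hq1' hrec' hbpos (fun _ => by norm_num) hx hxq (chebyshevU_nodes_strictMono t) hyq
  refine h.trans ?_
  simp only [ha, sub_self, zero_pow two_ne_zero, Finset.sum_const_zero, zero_add]
  have ht : (0 : ℝ) ≤ t := Nat.cast_nonneg t
  have hfrac : (t : ℝ) / (2 * (t : ℝ) + 1) ≤ 1 / 2 := by rw [div_le_iff₀ (by positivity)]; linarith
  calc 2 * ∑ i ∈ Finset.range t, (Real.sqrt (1 / 4) - Real.sqrt (b (i + 1))) ^ 2 ≤ 2 * ∑ i ∈ Finset.range t, 1 / 48 * (1 / (4 * ((i : ℝ) + 1) ^ 2 - 1)) := by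
        gcongr with i hi
        rw [hb]
        exact sqrt_legendre_coeff_sub_half_sq_le i
    _ = 2 * (1 / 48 * ((t : ℝ) / (2 * (t : ℝ) + 1))) := by rw [← Finset.mul_sum, sum_one_div_four_sq_sub_one]
    _ ≤ 1 / 48 := by linarith

/-- **Each increasing-ordered pair of Gauss–Legendre and second-kind Gauss–Chebyshev nodes differs by at most `3∕20`**, uniformly in the degree. [corollary; this file, §1201] -/
theorem legendre_chebyshevU_nodes_sub_abs_le {q : ℕ → ℝ[X]} {a b : ℕ → ℝ} (hq0 : q 0 = 1) (hq1 : q 1 = Polynomial.X - C (a 0))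
    (hrec : ∀ n, q (n + 2) = (Polynomial.X - C (a (n + 1))) * q (n + 1) - C (b (n + 1)) * q n) (ha : ∀ n, a n = 0)
    (hb : ∀ n, b (n + 1) = ((n : ℝ) + 1) ^ 2 / (4 * ((n : ℝ) + 1) ^ 2 - 1)) (hb0 : 0 < b 0) {t : ℕ} {x : Fin (t + 1) → ℝ} (hx : StrictMono x)
    (hxq : q (t + 1) = ∏ k, (Polynomial.X - C (x k))) (k : Fin (t + 1)) :
    |cos ((((Fin.rev k : Fin (t + 1)) : ℝ) + 1) * π / ((t : ℝ) + 2)) - x k| ≤ 3 / 20 := by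
  have h := (Finset.single_le_sum (f := fun k : Fin (t + 1) => (cos ((((Fin.rev k : Fin (t + 1)) : ℝ) + 1) * π / ((t : ℝ) + 2)) - x k) ^ 2)
    (fun k _ => sq_nonneg _) (Finset.mem_univ k)).trans (legendre_chebyshevU_nodes_hoffman_wielandt hq0 hq1 hrec ha hb hb0 hx hxq)
  exact abs_le_of_sq_le_sq (by simpa using h.trans (by norm_num : (1 / 48 : ℝ) ≤ (3 / 20) ^ 2)) (by norm_num)

end Summit.Ventures.HSemireg.Wedge.HankelOuter
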